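import Literature.AlgebraicGeometry.Resolution.AlterationsLemma32
import Literature.AlgebraicGeometry.Resolution.BlowupsFlatBaseChange
import Literature.AlgebraicGeometry.Resolution.CanonicalResolutionProofs
import HarnessLib

/-!
# De Jong's alteration theorem: Lemma 3.2 from the blow-ups of 3.4 (de Jong 1996, 3.1–3.4, 4.24)

Topic: `Literature/AlgebraicGeometry/Resolution`. Companion to `AlterationsLemma32.lean`, which
vendors de Jong 1996, Lemma 3.2 as printed — the semi-stable curve `f : X → Y` of a pair in
Situation 4.23 admits a projective modification, centred in `Sing(X)`, to a semi-stable curve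
smooth over `Y ∖ D` with `codim(Sing(X), X) ≥ 3` — as ONE named fact `DeJong1996Lemma32` (and
proves the bookkeeping of 4.24, `DeJong1996SemiStableCodimThree.of_lemma32`). This file is the
first layer of the decomposition of Lemma 3.2, cut where its printed proof cuts (p. 63):

> "3.4. Let `T` be an irreducible component of `Sing(X)` of codimension 2 in `X`. (Note that
> `codim(Sing(X), X) ≥ 2`, either by the formulae above, or by noting that `X` is normal.) …
> We write `φ : X' → X` for the blowing up of `X` in the ideal sheaf of `T` … We claim that
> (i) the center of `φ` lies in `Sing(X)`, (ii) `X'` is a semi-stable curve over `S`, smooth over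
> `S ∖ D`, (iii) the invariant `n_T` has dropped and (iv) if `X` is split, then so is `X'`. More
> precisely, (iii) means the following: Let `T'` be an irreducible component of `Sing(X)`. There
> exists at most one such irreducible component `T̃ ⊂ Sing(X')` lying above `T'`; we have
> `n_T̃ = n_{T'}`, unless `T' = T` in which case we have `n_T̃ = n_T - 2`. Clearly, the lemma
> follows from the claim, by repeatedly blowing up components of the singular locus of
> codimension 2 in `X` and induction on the numbers `n_T`."

Accordingly this file

* defines the **codimension-`≤ c` singular points** `Scheme.singularLocusCodimLE X c` of a
  scheme (the non-regular points `x` with `dim 𝒪_{X,x} ≤ c`; for `c = 2` and a pair in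
  Situation 4.23 these are exactly the generic points of the irreducible components `T` of
  `Sing(X)` of codimension `2` that 3.4 blows up);
* vendors the two printed inputs of the iteration as NAMED FACTS with the source's numbering:
  `DeJong1996SemiStableSingCodimTwo` (3.4, the parenthetical: `codim(Sing(X), X) ≥ 2`) and
  `DeJong1996SemiStableCodimTwoModification` (3.3–3.4, the Claim (i)–(iii) iterated along ONE
  codimension-2 component `T`, `⌊n_T/2⌋` blow-ups: a projective modification, an isomorphism off
  `T`, to a semi-stable curve smooth over `Y ∖ D` whose codimension-2 singular components
  correspond injectively to those of `X` other than `T`), in the sections-free vocabulary of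
  `DeJong1996Lemma32`;
* PROVES the glue: in a locally Noetherian scheme the dimension of the local ring
  drops strictly under generization (`ringKrullDim_stalk_lt_of_specializes`); a set of maximal
  points of a closed subset of a Noetherian sober space is finite
  (`Set.Finite.of_forall_specializes_eq`); hence — the singular locus of a scheme locally of
  finite type over any field being closed (`isOpen_regularLocus_of_locallyOfFiniteType_field`,
  `CanonicalResolutionProofs.lean`: fields are J-2, Matsumura Cor. to Thm. 30.5) — a pair in
  Situation 4.23 has finitely many codimension-2 singular points
  (`DeJong1996.SemiStablePair.finite_singularLocusCodimLE_two`, under 3.4's `codim ≥ 2`);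
  "isomorphism over the regular opens" composes
  (`isIso_morphismRestrict_comp_of_forall_isRegularLocalRing`); and the assembly
  `DeJong1996Lemma32.of_singCodimTwo_of_codimTwoModification` — **Lemma 3.2 from the two named
  facts, by induction on the number of codimension-2 singular components** ("Clearly, the lemma
  follows from the claim, by repeatedly blowing up …"): at each step the sections of Situation
  4.23 are lifted through the modification (`DeJong1996.SemiStablePair.exists_lift`, the
  parenthesis of 4.24: they land in smooth opens, which consist of regular points and so miss the
  centre) so that the two facts apply upstairs, modifications compose (2.17), and the composite
  is an isomorphism over every regular open `U` of `X` (`U` misses the singular point `x`, and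
  `φ⁻¹(U) ≅ U` is a regular open of `X'`); whence `DeJong1996SemiStableCodimThree`
  (`…of_singCodimTwo_of_codimTwoModification`, by `DeJong1996SemiStableCodimThree.of_lemma32`).

Both named facts are nodes to be decomposed further (3.4 parenthetical: normality of `X` —
flatness over the regular `Y`, smooth generic fibre, reduced nodal fibres; 3.3–3.4: the local
structure 2.23 `B ≅ A'⟦u, v⟧/(Q - h)`, `h = ε t₁^{n₁} ⋯ t_r^{n_r}`, the invariants `n_T`, the
three charts of the blow-up and the re-verification of 2.21 on geometric fibres); the owning
literature unit's `NOTES.md` keeps the DAG.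

## Sources

* A. J. de Jong, *Smoothness, semi-stability and alterations*, Publ. Math. IHÉS 83 (1996) 51–93:
  2.17, 2.20–2.23 (pp. 59–62), 3.1–3.4 (pp. 62–64), 4.4 (p. 66), 4.23–4.24 (p. 75).
* A. Grothendieck, J. Dieudonné, *EGA II*, 5.5.5 (ii) (compositions of projective morphisms to a
  quasi-compact base are projective), for "projective modification of a projective variety",
  and *EGA IV₄* 17.5.8 (iii) (smooth over regular is regular), via `AlterationsLemma32.lean`.
* H. Matsumura, *Commutative Ring Theory* (1986), §30, Cor. to Thm. 30.5 (the regular locus of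
  a finitely generated algebra over a field is open), via `CanonicalResolutionProofs.lean`.
-/

noncomputable section

open CategoryTheory CategoryTheory.Limits AlgebraicGeometry TopologicalSpace Topology

namespace Literature.AlgebraicGeometry.Resolution

universe u

/-! ## Codimension-`≤ c` singular points -/

/-- The **codimension-`≤ c` part of the singular locus** of a scheme `X`: the points `x` whose
local ring `𝒪_{X,x}` is not regular and has dimension `≤ c` (for a variety, `dim 𝒪_{X,x}` is
the codimension of the closure of `x`). For `c = 2` and `X` as in de Jong 1996, 3.1 (where
`codim(Sing(X), X) ≥ 2`, 3.4) these are the generic points of the irreducible components `T` of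
`Sing(X)` of codimension `2` in `X`, the centres blown up in 3.4. [cite: DeJong1996, 3.4, p. 63] -/
def Scheme.singularLocusCodimLE (X : Scheme.{u}) (c : ℕ) : Set X :=
  {x | ¬ IsRegularLocalRing (X.presheaf.stalk x) ∧ ringKrullDim (X.presheaf.stalk x) ≤ c}

/-- Membership in `Scheme.singularLocusCodimLE`. [folklore] -/
@[simp] theorem Scheme.mem_singularLocusCodimLE {X : Scheme.{u}} {c : ℕ} {x : X} :
    x ∈ Scheme.singularLocusCodimLE X c ↔
      ¬ IsRegularLocalRing (X.presheaf.stalk x) ∧ ringKrullDim (X.presheaf.stalk x) ≤ c :=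
  Iff.rfl

/-- The codimension-`≤ c` singular points lie in the singular locus `X ∖ Reg X`. [folklore] -/
theorem Scheme.singularLocusCodimLE_subset_compl_regularLocus (X : Scheme.{u}) (c : ℕ) :
    Scheme.singularLocusCodimLE X c ⊆ (Scheme.regularLocus X)ᶜ :=
  fun _ hx => hx.1

/-- Dimension bookkeeping in `WithBot ℕ∞` (the type of `ringKrullDim`): `¬ 3 ≤ d ↔ d ≤ 2`.
[folklore] -/
theorem WithBot.ENat.not_three_le_iff_le_two (d : WithBot ℕ∞) :
    ¬ (3 : WithBot ℕ∞) ≤ d ↔ d ≤ 2 := by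
  rw [not_le]
  induction d using WithBot.recBotCoe with
  | bot => exact ⟨fun _ => bot_le, fun _ => WithBot.bot_lt_coe (3 : ℕ∞)⟩
  | coe e =>
    show ((e : WithBot ℕ∞) < ((3 : ℕ∞) : WithBot ℕ∞) ↔ (e : WithBot ℕ∞) ≤ ((2 : ℕ∞) : WithBot ℕ∞))
    rw [WithBot.coe_lt_coe, WithBot.coe_le_coe]
    induction e using ENat.recTopCoe with
    | top => simp
    | coe m =>
      have hm : m < 3 ↔ m ≤ 2 := by omega
      exact_mod_cast hm

/-- `codim(Sing(X), X) ≥ 3` (every non-regular point has a local ring of dimension `≥ 3`, the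
form used in `DeJong1996SemiStableCodimThree`) iff there are no codimension-`≤ 2` singular
points. [folklore] -/
theorem Scheme.singularLocusCodimLE_two_eq_empty_iff (X : Scheme.{u}) :
    Scheme.singularLocusCodimLE X 2 = ∅ ↔
      ∀ x : X, ¬ IsRegularLocalRing (X.presheaf.stalk x) →
        (3 : WithBot ℕ∞) ≤ ringKrullDim (X.presheaf.stalk x) := by
  constructor
  · intro he x hx
    by_contra hlt
    have hmem : x ∈ Scheme.singularLocusCodimLE X 2 :=
      ⟨hx, (WithBot.ENat.not_three_le_iff_le_two _).mp hlt⟩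
    rw [he] at hmem
    exact hmem
  · intro h
    ext x
    simp only [Scheme.mem_singularLocusCodimLE, Set.mem_empty_iff_false, iff_false, not_and]
    intro hx hle
    exact (WithBot.ENat.not_three_le_iff_le_two _).mpr hle (h x hx)

/-! ## Dimension of local rings and specialization -/

/-- **The dimension of the local ring drops strictly under generization**: in a locally
Noetherian scheme, if `y ⤳ x` and `y ≠ x` then `dim 𝒪_{X,y} < dim 𝒪_{X,x}` (`dim 𝒪_{X,x}`
is the coheight of `x` in the specialization order, Stacks 02IZ, Mathlib
`ringKrullDim_stalk_eq_coheight`, and `𝒪_{X,y}` has finite dimension). [folklore] -/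
theorem ringKrullDim_stalk_lt_of_specializes {X : Scheme.{u}} [IsLocallyNoetherian X] {x y : X}
    (h : y ⤳ x) (hne : y ≠ x) :
    ringKrullDim (X.presheaf.stalk y) < ringKrullDim (X.presheaf.stalk x) := by
  rw [ringKrullDim_stalk_eq_coheight, ringKrullDim_stalk_eq_coheight]
  have hlt : x < y := by
    refine lt_of_le_not_ge (Scheme.le_iff_specializes.mpr h) fun h' => hne ?_
    exact (h.antisymm (Scheme.le_iff_specializes.mp h')).eq
  have hfin : Order.coheight y < ⊤ := by
    have h1 := ringKrullDim_lt_top (R := X.presheaf.stalk y)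
    rw [ringKrullDim_stalk_eq_coheight] at h1
    by_contra htop
    rw [not_lt, top_le_iff] at htop
    rw [htop] at h1
    exact lt_irrefl _ h1
  exact_mod_cast Order.coheight_strictAnti hlt hfin

/-! ## Maximal points of a closed subset of a Noetherian sober space -/

/-- **A set of maximal points of a closed subset of a Noetherian sober `T₀` space is finite**: if
`M ⊆ S`, `S` closed, and no point of `M` has a proper generization inside `S`, then every point
of `M` is the generic point of an irreducible component of the (Noetherian, sober) subspace `S`,
of which there are finitely many. [folklore] -/
theorem Set.Finite.of_forall_specializes_eq {α : Type u} [TopologicalSpace α] [NoetherianSpace α]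
    [QuasiSober α] [T0Space α] {S M : Set α} (hS : IsClosed S) (hMS : M ⊆ S)
    (hmax : ∀ x ∈ M, ∀ y ∈ S, y ⤳ x → y = x) : M.Finite := by
  haveI : QuasiSober S := hS.isClosedEmbedding_subtypeVal.quasiSober
  have hfin : (genericPoints S).Finite :=
    genericPoints.finite NoetherianSpace.finite_irreducibleComponents
  refine (hfin.image Subtype.val).subset fun x hx => ?_
  -- the generic point of the irreducible component of `x` in `S` generizes `x`, hence is `x`
  let x₀ : S := ⟨x, hMS hx⟩
  let C : irreducibleComponents S := ⟨irreducibleComponent x₀,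
    irreducibleComponent_mem_irreducibleComponents x₀⟩
  let y₀ : genericPoints S := genericPoints.ofComponent C
  have hy : IsGenericPoint y₀.1 (irreducibleComponent x₀) := genericPoints.isGenericPoint_ofComponent C
  have hspec : y₀.1 ⤳ x₀ := hy.specializes mem_irreducibleComponent
  have heq : (y₀.1 : α) = x := hmax x hx _ y₀.1.2 (hspec.map continuous_subtype_val)
  have heq' : y₀.1 = x₀ := Subtype.ext heq
  refine ⟨x₀, ?_, rfl⟩
  rw [← heq']
  exact y₀.2

/-! ## Finiteness of the codimension-2 singular points -/

/-- In a Noetherian scheme locally of finite type over a field in which every non-regular point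
has a local ring of dimension `≥ 2` (`codim(Sing(X), X) ≥ 2`), a codimension-`≤ 2` singular
point has no proper generization in the closed (`isOpen_regularLocus_of_locallyOfFiniteType_field`:
fields are J-2, Matsumura Cor. to Thm. 30.5) set `Sing(X)` — it is the generic point of an
irreducible component of `Sing(X)` of codimension `2`; hence there are finitely many of them.
[folklore] -/
theorem Scheme.finite_singularLocusCodimLE_two {k : Type u} [Field k] {X : Scheme.{u}}
    [IsNoetherian X] (f : X ⟶ Spec (.of k)) [LocallyOfFiniteType f]
    (hcodim : ∀ x : X, ¬ IsRegularLocalRing (X.presheaf.stalk x) →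
      (2 : WithBot ℕ∞) ≤ ringKrullDim (X.presheaf.stalk x)) :
    (Scheme.singularLocusCodimLE X 2).Finite := by
  refine Set.Finite.of_forall_specializes_eq
    (isOpen_regularLocus_of_locallyOfFiniteType_field f).isClosed_compl
    (Scheme.singularLocusCodimLE_subset_compl_regularLocus X 2) fun x hx y hy hyx => ?_
  by_contra hne
  have hlt := ringKrullDim_stalk_lt_of_specializes hyx hne
  have h2 : (2 : WithBot ℕ∞) ≤ ringKrullDim (X.presheaf.stalk y) := hcodim y hy
  exact absurd (lt_of_le_of_lt h2 (lt_of_lt_of_le hlt hx.2)) (lt_irrefl _)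

/-! ## Isomorphisms over the regular opens compose -/

/-- If `φ : X' → X` is an isomorphism over the open `U ⊆ X` consisting of regular points and
`ψ : X'' → X'` is an isomorphism over every open of `X'` consisting of regular points, then
`ψ ≫ φ` is an isomorphism over `U`: `φ⁻¹(U) ≅ U` consists of regular points
(`mem_regularLocus_iff_of_isIso_morphismRestrict`) and
`(ψ ≫ φ)|_U = ψ|_{φ⁻¹U} ≫ φ|_U`. [folklore] -/
theorem isIso_morphismRestrict_comp_of_forall_isRegularLocalRing {X'' X' X : Scheme.{u}}
    (ψ : X'' ⟶ X') (φ : X' ⟶ X) (U : X.Opens) [IsIso (φ ∣_ U)]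
    (hψ : ∀ V : X'.Opens, (∀ x ∈ V, IsRegularLocalRing (X'.presheaf.stalk x)) → IsIso (ψ ∣_ V))
    (hU : ∀ x ∈ U, IsRegularLocalRing (X.presheaf.stalk x)) : IsIso ((ψ ≫ φ) ∣_ U) := by
  rw [morphismRestrict_comp]
  have h2 : IsIso (ψ ∣_ φ ⁻¹ᵁ U) := hψ _ fun x hx =>
    (mem_regularLocus_iff_of_isIso_morphismRestrict φ U x hx).mpr (hU _ hx)
  exact @IsIso.comp_isIso _ _ _ _ _ _ _ h2 ‹IsIso (φ ∣_ U)›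

/-! ## 3.4 as named facts -/

/-- NAMED FACT — **de Jong 1996, 3.4 (parenthetical): the singular locus of a semi-stable curve
over a regular base, smooth over the complement of a strict normal crossings divisor, has
codimension `≥ 2`.** In the setting 3.1 (`S` an excellent regular scheme, `D ⊂ S` a strict
normal crossings divisor, `f : X → S` a semi-stable curve smooth over `S ∖ D`): "(Note that
`codim(Sing(X), X) ≥ 2`, either by the formulae above [3.3: `B ≅ A'⟦u, v⟧/(Q - ε t₁^{n₁} ⋯ t_r^{n_r})`],
or by noting that `X` is normal.)" Rendered for a pair in Situation 4.23
(`DeJong1996.SemiStablePair f g D τ` over an algebraically closed `k`, `S = Y` a nonsingular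
projective variety): every non-regular point `x` of `X` has `dim 𝒪_{X,x} ≥ 2`. Users take
`(h : DeJong1996SemiStableSingCodimTwo)`; it is a node to decompose further (flatness of `f`
over the regular `Y`, smoothness over `Y ∖ D`, reducedness of the nodal fibres at their generic
points). [cite: DeJong1996, 3.4, p. 63] -/
def DeJong1996SemiStableSingCodimTwo : Prop :=
  ∀ (k : Type u) [Field k] [IsAlgClosed k] (X Y : Scheme.{u}) (f : X ⟶ Y)
    (g : Y ⟶ Spec (.of k)) (D : Set Y) (n : ℕ) (τ : Fin n → (Y ⟶ X)),
    DeJong1996.SemiStablePair f g D τ →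
      ∀ x : X, ¬ IsRegularLocalRing (X.presheaf.stalk x) →
        (2 : WithBot ℕ∞) ≤ ringKrullDim (X.presheaf.stalk x)

/-- NAMED FACT — **de Jong 1996, 3.3–3.4: blowing up a codimension-2 component of the singular
locus of a semi-stable curve (the Claim of 3.4, iterated along one component).** Setting 3.1, `T`
an irreducible component of `Sing(X)` of codimension `2` in `X` (3.4: "`T` maps onto a component
`Dᵢ` of `D` and the map is finite unramified. As `Dᵢ` is regular, we conclude that `T` is
regular too"; at `x ∈ T`, `B ≅ A'⟦u, v⟧/(Q - t₁^{n₁} ⋯ t_r^{n_r})`, 3.3, and "the integer `n₁`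
must be `≥ 2` … it is an invariant `n_T`"): "We write `φ : X' → X` for the blowing up of `X` in
the ideal sheaf of `T` … We claim that (i) the center of `φ` lies in `Sing(X)`, (ii) `X'` is a
semi-stable curve over `S`, smooth over `S ∖ D`, (iii) the invariant `n_T` has dropped and
(iv) if `X` is split, then so is `X'`. More precisely, (iii) means the following: Let `T'` be an
irreducible component of `Sing(X)`. There exists at most one such irreducible component
`T̃ ⊂ Sing(X')` lying above `T'`; we have `n_T̃ = n_{T'}` unless `T' = T` in which case we have
`n_T̃ = n_T - 2` [chart "`t₁ ≠ 0`": `A[u, v, u', v']/(u - t₁u', v - t₁v', u'v' - t₁^{n₁-2} t₂^{n₂} ⋯ t_r^{n_r})`,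
"The "new" component `T̃` lying over `T` is given by `u' = v' = t₁ = 0`, unless `n₁ = 2, 3`,
then `T̃` lying over `T` does not exist"] … by repeatedly blowing up components of the singular
locus of codimension 2 in `X` and induction on the numbers `n_T`." Rendered, in the
sections-free vocabulary of `DeJong1996Lemma32`, for the curve `f : X → Y` of a pair in
Situation 4.23 over an algebraically closed `k` (`S = Y`, a nonsingular projective variety: an
excellent regular scheme; the sections `τ` play no role) and for the `⌊n_T/2⌋` successive
blow-ups of `T` and of the components `T̃` over it, composed: for every non-regular `x ∈ X` with
`dim 𝒪_{X,x} ≤ 2` there are a modification `φ : X' → X` (`IsModification`, 2.17) with `X'`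
projective over `k` ("projective modification" of the projective `X`, EGA II 5.5.5 (ii)) such
that: (i) `φ` is an isomorphism over every open `U ∌ x` of `X` (the centre is `T = cl{x}`: an
open meets `T` iff it contains its generic point); (ii) `φ ≫ f` is a semi-stable curve
(`IsSemiStableCurve`, 2.21), smooth over `Y ∖ D`; (iii) `φ` maps the non-regular points `x'` of
`X'` with `dim 𝒪_{X',x'} ≤ 2` injectively to non-regular points of `X` with `dim ≤ 2` other
than `x`. Here, by the parenthetical of 3.4 (`DeJong1996SemiStableSingCodimTwo`, for `X` and for
`X'`), the non-regular points with local ring of dimension `≤ 2` are exactly the generic points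
of the irreducible components of the singular locus of codimension `2`, so that `x` is the
generic point of such a `T` and (iii) reads as printed: no codimension-2 component of `Sing(X')`
lies over `T` any more, and at most one — its strict transform, isomorphic to it off `T` — over
each other `T'`. (iv) is not rendered (4.22, 4.24: over an algebraically closed field only closed
points are considered, "so that the situation is automatically split"). Users take
`(h : DeJong1996SemiStableCodimTwoModification)`; it is a node to decompose further (2.23, the
invariants `n_T`, the three charts, 2.21 for `X'`).
[cite: DeJong1996, 3.3–3.4, pp. 63–64] -/
def DeJong1996SemiStableCodimTwoModification : Prop :=
  ∀ (k : Type u) [Field k] [IsAlgClosed k] (X Y : Scheme.{u}) (f : X ⟶ Y)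
    (g : Y ⟶ Spec (.of k)) (D : Set Y) (n : ℕ) (τ : Fin n → (Y ⟶ X))
    (hS : DeJong1996.SemiStablePair f g D τ),
    ∀ x : X, ¬ IsRegularLocalRing (X.presheaf.stalk x) →
      ringKrullDim (X.presheaf.stalk x) ≤ 2 →
        ∃ (X' : Scheme.{u}) (φ : X' ⟶ X), IsModification φ ∧
          Literature.AlgebraicGeometry.Motives.IsProjectiveOver (Over.mk (φ ≫ f ≫ g)) ∧
          (∀ U : X.Opens, x ∉ U → IsIso (φ ∣_ U)) ∧
          IsSemiStableCurve (φ ≫ f) ∧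
          Smooth ((φ ≫ f) ∣_ ⟨Dᶜ, hS.isStrictNormalCrossingsDivisor.isClosed.isOpen_compl⟩) ∧
          Set.MapsTo φ (Scheme.singularLocusCodimLE X' 2)
            (Scheme.singularLocusCodimLE X 2 \ {x}) ∧
          Set.InjOn φ (Scheme.singularLocusCodimLE X' 2)

/-! ## The glue: Lemma 3.2 by induction on the number of codimension-2 components -/

namespace DeJong1996

namespace SemiStablePair

variable {k : Type u} [Field k] {X Y : Scheme.{u}} {f : X ⟶ Y} {g : Y ⟶ Spec (.of k)}
  {D : Set Y} {n : ℕ} {τ : Fin n → (Y ⟶ X)}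

/-- In Situation 4.23, `X` is Noetherian. [folklore] -/
theorem isNoetherian (h : SemiStablePair f g D τ) : IsNoetherian X :=
  isNoetherian_of_isProjectiveOver (f ≫ g) h.isProjectiveOver

/-- In Situation 4.23 the regular locus of `X` is open (`X` is of finite type over a field).
[cite: Matsumura1987, §30, Cor. to Thm. 30.5] -/
theorem isOpen_regularLocus (h : SemiStablePair f g D τ) : IsOpen (Scheme.regularLocus X) :=
  haveI := h.locallyOfFiniteType
  isOpen_regularLocus_of_locallyOfFiniteType_field (f ≫ g)

/-- **A semi-stable pair has finitely many codimension-2 singular components** (de Jong 1996,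
3.4: the `T` range over irreducible components of the closed `Sing(X)` of the Noetherian `X`),
given `codim(Sing(X), X) ≥ 2` (`DeJong1996SemiStableSingCodimTwo`). [cite: DeJong1996, 3.4, p. 63] -/
theorem finite_singularLocusCodimLE_two [IsAlgClosed k] (h0 : DeJong1996SemiStableSingCodimTwo.{u})
    (h : SemiStablePair f g D τ) : (Scheme.singularLocusCodimLE X 2).Finite :=
  haveI := h.isNoetherian
  haveI := h.locallyOfFiniteType
  Scheme.finite_singularLocusCodimLE_two (f ≫ g) (h0 k X Y f g D n τ h)

/-- A non-regular point lies in no open on which `f` is smooth (3.1: `Sing(X) ⊆ Sing(f)`,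
`isRegularLocalRing_of_smooth`); in particular the sections of Situation 4.23 come with smooth
open neighbourhoods missing it. [cite: DeJong1996, 3.1, p. 62] -/
theorem notMem_of_smooth (hS : SemiStablePair f g D τ) {U : X.Opens} (hU : Smooth (U.ι ≫ f))
    {x : X} (hx : ¬ IsRegularLocalRing (X.presheaf.stalk x)) : x ∉ U :=
  fun hxU => hx (hS.isRegularLocalRing_of_smooth hU hxU)

/-- The trivial case of Lemma 3.2: if `X` has no codimension-`≤ 2` singular point, the
identity is the required modification. [folklore] -/
theorem exists_lemma32_of_singularLocusCodimLE_eq_empty (hS : SemiStablePair f g D τ)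
    (he : Scheme.singularLocusCodimLE X 2 = ∅) :
    ∃ (X₁ : Scheme.{u}) (φ₁ : X₁ ⟶ X), IsModification φ₁ ∧
      Literature.AlgebraicGeometry.Motives.IsProjectiveOver (Over.mk (φ₁ ≫ f ≫ g)) ∧
      (∀ U : X.Opens, (∀ x ∈ U, IsRegularLocalRing (X.presheaf.stalk x)) → IsIso (φ₁ ∣_ U)) ∧
      IsSemiStableCurve (φ₁ ≫ f) ∧
      Smooth ((φ₁ ≫ f) ∣_ ⟨Dᶜ, hS.isStrictNormalCrossingsDivisor.isClosed.isOpen_compl⟩) ∧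
      ∀ x : X₁, ¬ IsRegularLocalRing (X₁.presheaf.stalk x) →
        (3 : WithBot ℕ∞) ≤ ringKrullDim (X₁.presheaf.stalk x) := by
  haveI := hS.isIntegral
  refine ⟨X, 𝟙 X, ⟨inferInstance, inferInstance, ⊤, by simp, by simp, inferInstance⟩, ?_,
    fun U _ => inferInstance, ?_, ?_, (Scheme.singularLocusCodimLE_two_eq_empty_iff X).mp he⟩
  · simpa only [Category.id_comp] using hS.isProjectiveOver
  · simpa only [Category.id_comp] using hS.isSemiStableCurve
  · rw [Category.id_comp]
    exact hS.smooth_morphismRestrict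

end SemiStablePair

end DeJong1996

/-- **de Jong 1996, Lemma 3.2 (`DeJong1996Lemma32`) from the two printed inputs of its proof**:
`codim(Sing(X), X) ≥ 2` (`DeJong1996SemiStableSingCodimTwo`, 3.4) and the blow-up of a
codimension-2 component of `Sing(X)` (`DeJong1996SemiStableCodimTwoModification`, the Claim of
3.4 iterated along one component). "Clearly, the lemma follows from the claim, by repeatedly
blowing up components of the singular locus of codimension 2 in `X` and induction on the
numbers `n_T`": induction on the (finite, `SemiStablePair.finite_singularLocusCodimLE_two`) number
of codimension-2 singular components, for all pairs in Situation 4.23 over the fixed base; if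
there is none, `codim(Sing(X), X) ≥ 3` already and `φ₁ = 𝟙`; otherwise remove one component
`T = cl{x}` by the Claim — the new curve `φ ≫ f` is semi-stable, smooth over `Y ∖ D`, with `X'`
projective, and carries lifted sections making it a pair in Situation 4.23 again
(`SemiStablePair.exists_lift`, 4.24: the sections land in smooth opens, which consist of regular
points, 3.1, hence miss `x`, so `φ` is an isomorphism over them), with fewer codimension-2
singular components (`φ` is injective on them and misses `x`) — apply the induction hypothesis
upstairs and compose: modifications compose (2.17), projectivity, semi-stability and smoothness
off `D` are those of the composite curve, and the composite is an isomorphism over every regular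
open `U` of `X` (`φ` is, `U` missing the singular point `x`; and `φ⁻¹(U) ≅ U` is a regular open
of `X'`). [cite: DeJong1996, 3.2–3.4, pp. 62–64] -/
theorem DeJong1996Lemma32.of_singCodimTwo_of_codimTwoModification
    (h0 : DeJong1996SemiStableSingCodimTwo.{u})
    (h1 : DeJong1996SemiStableCodimTwoModification.{u}) : DeJong1996Lemma32.{u} := by
  intro k _ _ X Y f g D n τ hS
  -- induction on the number of codimension-2 singular components, over all pairs on `(Y, D)`
  suffices H : ∀ (m : ℕ) (X : Scheme.{u}) (f : X ⟶ Y) (τ : Fin n → (Y ⟶ X))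
      (hS : DeJong1996.SemiStablePair f g D τ), (Scheme.singularLocusCodimLE X 2).ncard ≤ m →
        ∃ (X₁ : Scheme.{u}) (φ₁ : X₁ ⟶ X), IsModification φ₁ ∧
          Literature.AlgebraicGeometry.Motives.IsProjectiveOver (Over.mk (φ₁ ≫ f ≫ g)) ∧
          (∀ U : X.Opens, (∀ x ∈ U, IsRegularLocalRing (X.presheaf.stalk x)) →
            IsIso (φ₁ ∣_ U)) ∧
          IsSemiStableCurve (φ₁ ≫ f) ∧
          Smooth ((φ₁ ≫ f) ∣_ ⟨Dᶜ, hS.isStrictNormalCrossingsDivisor.isClosed.isOpen_compl⟩) ∧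
          ∀ x : X₁, ¬ IsRegularLocalRing (X₁.presheaf.stalk x) →
            (3 : WithBot ℕ∞) ≤ ringKrullDim (X₁.presheaf.stalk x) from
    H _ X f τ hS le_rfl
  intro m
  induction m with
  | zero =>
    intro X f τ hS hm
    have hfin := hS.finite_singularLocusCodimLE_two h0
    exact hS.exists_lemma32_of_singularLocusCodimLE_eq_empty
      ((Set.ncard_eq_zero hfin).mp (Nat.le_zero.mp hm))
  | succ m ih =>
    intro X f τ hS hm
    have hfin := hS.finite_singularLocusCodimLE_two h0
    by_cases he : Scheme.singularLocusCodimLE X 2 = ∅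
    · exact hS.exists_lemma32_of_singularLocusCodimLE_eq_empty he
    -- 3.4: a codimension-2 component `T = cl{x}` of `Sing(X)`; blow it up (and its successors)
    obtain ⟨x, hx⟩ := Set.nonempty_iff_ne_empty.mpr he
    obtain ⟨X', φ, hφ, hproj, hiso, hss, hsm, hmaps, hinj⟩ := h1 k X Y f g D n τ hS x hx.1 hx.2
    haveI := hφ.isIntegral
    -- 4.24: the sections lift, `φ` being an isomorphism over their smooth neighbourhoods
    have hiso' : ∀ i, ∃ U : X.Opens, Set.range (τ i) ⊆ (U : Set X) ∧ Smooth (U.ι ≫ f) ∧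
        IsIso (φ ∣_ U) := fun i => by
      obtain ⟨U, hU, hUf⟩ := hS.exists_smooth i
      exact ⟨U, hU, hUf, hiso U (hS.notMem_of_smooth hUf hx.1)⟩
    obtain ⟨τ', -, hS', -⟩ := hS.exists_lift hproj hiso' hss hsm
    -- fewer codimension-2 singular components upstairs
    have hm' : (Scheme.singularLocusCodimLE X' 2).ncard ≤ m := by
      have h₁ := Set.ncard_le_ncard_of_injOn φ hmaps hinj (hfin.subset Set.sdiff_subset)
      have h₂ := Set.ncard_sdiff_singleton_of_mem hx
      have h₃ : 0 < (Scheme.singularLocusCodimLE X 2).ncard := (Set.ncard_pos hfin).mpr ⟨x, hx⟩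
      omega
    -- induction upstairs, then compose (2.17)
    obtain ⟨X₁, ψ, hψ, hproj₁, hisoψ, hss₁, hsm₁, hcodim⟩ := ih X' (φ ≫ f) τ' hS' hm'
    refine ⟨X₁, ψ ≫ φ, hψ.comp hφ, ?_, fun U hU => ?_, ?_, ?_, hcodim⟩
    · simpa only [Category.assoc] using hproj₁
    · -- `x ∉ U` (a singular point), so `φ` is an isomorphism over `U`, and `ψ` over `φ⁻¹(U)`
      haveI : IsIso (φ ∣_ U) := hiso U fun hxU => hx.1 (hU x hxU)
      exact isIso_morphismRestrict_comp_of_forall_isRegularLocalRing ψ φ U hisoψ hU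
    · simpa only [Category.assoc] using hss₁
    · rw [Category.assoc]
      exact hsm₁

/-- **de Jong 1996, 4.24, first sentence (`DeJong1996SemiStableCodimThree`) from the two
printed inputs of the proof of Lemma 3.2** (`DeJong1996SemiStableSingCodimTwo`,
`DeJong1996SemiStableCodimTwoModification`), through `DeJong1996Lemma32`
(`DeJong1996SemiStableCodimThree.of_lemma32`, which lifts the sections and the boundary).
[cite: DeJong1996, 3.2–3.4 and 4.24, pp. 62–64, 75] -/
theorem DeJong1996SemiStableCodimThree.of_singCodimTwo_of_codimTwoModification
    (h0 : DeJong1996SemiStableSingCodimTwo.{u})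
    (h1 : DeJong1996SemiStableCodimTwoModification.{u}) :
    DeJong1996SemiStableCodimThree.{u} :=
  DeJong1996SemiStableCodimThree.of_lemma32
    (DeJong1996Lemma32.of_singCodimTwo_of_codimTwoModification h0 h1)

end Literature.AlgebraicGeometry.Resolution

end
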